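import Summits.CriticalPhenomena.CardyFormulaZ2.Theorems.CardyMeckeFlipMeckeRigidityDilationAPI

/-!
# Self-duality of crossing cylinders is preserved by dilations

Route `Summits/CriticalPhenomena/CardyFormulaZ2/Theses/CardyMeckeFlip`, crux `MeckeRigidity`
(item stmt-CriticalPhenomena-14826), line `registered`, stub `selfDual_map_dilate` of the
similarity-covariance package.

Clause (D) of the crux is exact self-duality on crossing cylinders: for every finite family of
quads `Q`, its family of "transposes" `Qt` (same carrier, sides rotated by one) and every
`A ⊆ Set (Fin n)`, `P {S | {i | Qᵢ ∈ S} ∈ A} = P {S | {i | Qtᵢ ∉ S} ∈ A}`.  We show that (D) passes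
to the push-forward `(S_t)_* P` under the plane dilation `w ↦ t w` (`t > 0`): both cylinder events
are measurable (functions of a crossing pattern, `measurable_comp_quadPattern`), their preimages
under `S_t` are the same cylinders for the inversely dilated families (`setOf_mem_dilate`), and the
transposition data are images of equal sets under `w ↦ t⁻¹ w` (`carrier_quad_dilate`,
`side_quad_dilate`).
-/

noncomputable section

open MeasureTheory Set Metric Filter Topology
open Literature.Probability.Percolation Literature.Probability.Percolation.QuadCrossing

namespace Summit.CriticalPhenomena.CardyFormulaZ2.Theorems.CardyMeckeFlip

/-- The non-crossing pattern of a family of quads in a dilated configuration is the non-crossing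
pattern of the inversely dilated family. [folklore] -/
theorem setOf_not_mem_dilate (t : ℝ) (ht : t ≠ 0) {n : ℕ} (Q : Fin n → Quad (univ : Set ℂ))
    (S : QuadConfig (univ : Set ℂ)) :
    {i | Q i ∉ QuadConfig.dilate t ht S} = {i | (Q i).dilate t⁻¹ (inv_ne_zero ht) ∉ S} := by
  ext i
  exact not_congr (mem_quadConfig_dilate_iff t ht S (Q i))

/-- `S_t⁻¹'` of a crossing cylinder is the crossing cylinder of the inversely dilated family.
[folklore] -/
theorem preimage_dilate_setOf_quadPattern_mem (t : ℝ) (ht : t ≠ 0) {n : ℕ}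
    (Q : Fin n → Quad (univ : Set ℂ)) (A : Set (Set (Fin n))) :
    QuadConfig.dilate t ht ⁻¹' {S : QuadConfig (univ : Set ℂ) | {i | Q i ∈ S} ∈ A} =
      {S | {i | (Q i).dilate t⁻¹ (inv_ne_zero ht) ∈ S} ∈ A} := by
  ext S
  rw [mem_preimage, mem_setOf_eq, mem_setOf_eq, setOf_mem_dilate]

/-- `S_t⁻¹'` of a non-crossing cylinder is the non-crossing cylinder of the inversely dilated
family. [folklore] -/
theorem preimage_dilate_setOf_quadPattern_notMem (t : ℝ) (ht : t ≠ 0) {n : ℕ}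
    (Q : Fin n → Quad (univ : Set ℂ)) (A : Set (Set (Fin n))) :
    QuadConfig.dilate t ht ⁻¹' {S : QuadConfig (univ : Set ℂ) | {i | Q i ∉ S} ∈ A} =
      {S | {i | (Q i).dilate t⁻¹ (inv_ne_zero ht) ∉ S} ∈ A} := by
  ext S
  rw [mem_preimage, mem_setOf_eq, mem_setOf_eq, setOf_not_mem_dilate]

/-- **Transposition data are dilation covariant**: if `Qt` is a transpose of `Q` (same carrier,
sides rotated by one) then `S_t Qt` is a transpose of `S_t Q`. [folklore] -/
theorem transpose_quad_dilate (t : ℝ) (ht : t ≠ 0) {Q Qt : Quad (univ : Set ℂ)}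
    (h : Qt.carrier = Q.carrier ∧ Qt.side 0 = Q.side 1 ∧ Qt.side 1 = Q.side 2 ∧
      Qt.side 2 = Q.side 3 ∧ Qt.side 3 = Q.side 0) :
    (Qt.dilate t ht).carrier = (Q.dilate t ht).carrier ∧
      (Qt.dilate t ht).side 0 = (Q.dilate t ht).side 1 ∧
      (Qt.dilate t ht).side 1 = (Q.dilate t ht).side 2 ∧
      (Qt.dilate t ht).side 2 = (Q.dilate t ht).side 3 ∧
      (Qt.dilate t ht).side 3 = (Q.dilate t ht).side 0 := by
  obtain ⟨hc, h0, h1, h2, h3⟩ := h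
  simp only [carrier_quad_dilate, side_quad_dilate, hc, h0, h1, h2, h3, and_self]

/-- **Clause (D) transports under dilations** (registered stub `selfDual_map_dilate` of item
stmt-CriticalPhenomena-14826): if `P` is exactly self-dual on crossing cylinders, so is
`(S_t)_* P` for every `t > 0`. [folklore] -/
theorem selfDual_map_dilate : ∀ (P : Measure (QuadConfig (Set.univ : Set ℂ))) (t : ℝ) (ht : 0 < t), (∀ (n : ℕ) (Q Qt : Fin n → Quad (Set.univ : Set ℂ)), (∀ i, (Qt i).carrier = (Q i).carrier ∧ (Qt i).side 0 = (Q i).side 1 ∧ (Qt i).side 1 = (Q i).side 2 ∧ (Qt i).side 2 = (Q i).side 3 ∧ (Qt i).side 3 = (Q i).side 0) → ∀ A : Set (Set (Fin n)), P {S | {i | Q i ∈ S} ∈ A} = P {S | {i | Qt i ∉ S} ∈ A}) → ∀ (n : ℕ) (Q Qt : Fin n → Quad (Set.univ : Set ℂ)), (∀ i, (Qt i).carrier = (Q i).carrier ∧ (Qt i).side 0 = (Q i).side 1 ∧ (Qt i).side 1 = (Q i).side 2 ∧ (Qt i).side 2 = (Q i).side 3 ∧ (Qt i).side 3 = (Q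 i).side 0) → ∀ A : Set (Set (Fin n)), (Measure.map (QuadConfig.dilate t ht.ne') P) {S | {i | Q i ∈ S} ∈ A} = (Measure.map (QuadConfig.dilate t ht.ne') P) {S | {i | Qt i ∉ S} ∈ A} := by
  intro P t ht hD n Q Qt hQt A
  -- the two cylinder events are measurable: functions of a crossing pattern
  -- (`measurable_comp_quadPattern`; cf. `Cruxes.Z2LimitsSymmetric.measurableSet_pattern`)
  have hmeas : MeasurableSet {S : QuadConfig (univ : Set ℂ) | {i | Q i ∈ S} ∈ A} :=
    measurableSet_setOf.2 (measurable_comp_quadPattern Q fun B => B ∈ A)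
  have hmeas' : MeasurableSet {S : QuadConfig (univ : Set ℂ) | {i | Qt i ∉ S} ∈ A} :=
    measurableSet_setOf.2 (measurable_comp_quadPattern Qt fun B => Bᶜ ∈ A)
  rw [Measure.map_apply (measurable_quadConfig_dilate t ht.ne') hmeas,
    Measure.map_apply (measurable_quadConfig_dilate t ht.ne') hmeas',
    preimage_dilate_setOf_quadPattern_mem, preimage_dilate_setOf_quadPattern_notMem]
  exact hD n (fun i => (Q i).dilate t⁻¹ (inv_ne_zero ht.ne'))
    (fun i => (Qt i).dilate t⁻¹ (inv_ne_zero ht.ne'))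
    (fun i => transpose_quad_dilate t⁻¹ (inv_ne_zero ht.ne') (hQt i)) A

end Summit.CriticalPhenomena.CardyFormulaZ2.Theorems.CardyMeckeFlip

end
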